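import Mathlib
import Summits.MatrixMultiplication.MatrixMultiplication.Theorems.SnSubsetDichotomyNoThresholdSubsetTripleSqChange
import Summits.MatrixMultiplication.MatrixMultiplication.Theorems.SnSubsetDichotomyNoThresholdSubsetTripleCondVar

/-!
# (L3): the conditional second moment of the one-step change of `q` is at most `72 q + 32`

Line `klr-graded-polynomial-method`, crux `SnSubsetDichotomy.NoThresholdSubsetTriple` (stmt-MatrixMultiplication-8302), lead c7
report app. A.  Composition of the landed `sq_change_le` ((L2′): `|q(ν ∪ z) − q(ν)| ≤ 6√q(ν) + 11/3` for every corner `z`,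
p155265) with `condVar_le_of_sq_change` (p155192): for every Young diagram `ν` (finite lower set of cells),
`Σ_{z addable} p_z · (q(ν ∪ z) − q(ν))² ≤ 72·q(ν) + 32` — hypothesis (L3) of the (Q)-lemma `selfBounding_timeSum_tail` (p152256)
for the process `q_t = sqEnergy ν_t` of the Plancherel growth, with `C = 72` (after `q + 1 ≥ (72q + 32)/72`).
-/

open scoped BigOperators
open Literature.RepresentationTheory.FiniteGroups (addableNodes IsAddableNode)

namespace Summit.MatrixMultiplication.MatrixMultiplication.Theorems

open PlancherelStep

set_option linter.dupNamespace false in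
/-- **(L3)** For every Young diagram `ν`: `Σ_{z ∈ addableNodes ν} p_z (q(ν∪z) − q(ν))² ≤ 72·q(ν) + 32`, `q = sqEnergy`,
`p = transProb` (lead c7 report, appendix A; from (L2′) `sq_change_le` and `Σ_z p_z = 1`). -/
theorem condVar_le : ∀ (ν : Finset (ℕ × ℕ)), IsLowerSet (ν : Set (ℕ × ℕ)) →
    ∑ z ∈ addableNodes ν, transProb ν z * (sqEnergy (insert z ν) - sqEnergy ν) ^ 2 ≤
      72 * sqEnergy ν + 32 :=
  condVar_le_of_sq_change sq_change_le

end Summit.MatrixMultiplication.MatrixMultiplication.Theorems
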